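import Summits.BirchSwinnertonDyer.Rank1Residual.Partition.EisensteinKernelAbscissaIntegral
import Summits.BirchSwinnertonDyer.Rank1Residual.Additive.OrdinaryThreeCriteria
import Summits.BirchSwinnertonDyer.Rank1Residual.X11b.LocalTorsionMultiplicative
import HarnessLib

/-!
# The Greenberg–Vatsal type at `3` from the kernel abscissa alone:
# `GVPar W 3 ↔ (0 < b₂ + 12·x₀ ↔ x₀ ∉ ℤ)` at a good ordinary or multiplicative `3`

HONEST FRAMING (cell `b2b-bsdres-*`, verbatim): the goal of the cell is to DELETE the
COMBINATION-SHAPED residual classes for ALL analytic-rank ≤ 1 curves over ℚ — "full BSD formula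
for every rank ≤ 1 curve in class C" assembled STRICTLY from published theorems — so that the
rank-≤1 remainder becomes exactly the CONSTRUCTION-SHAPED classes, which are TYPED (missing-input
Props), NOT attempted; this is not "finishing BSD". Off-peak literature typer `b2b-bsdres-lit-cgls`
(CGLS22 / GV00, the reducible = Eisenstein column), session 13, file 7 of the `EisensteinKernel*`
series (sequel of `EisensteinKernelAbscissa`, `EisensteinKernelAbscissaIntegral`). Theorems only —
no definition, no named fact, nothing booked, no label changed; research-route bookkeeping, no claim
about BSD is made here.

* `not_three_dvd_b₂_of_goodOrd` / `not_three_dvd_b₂_of_mult` — for a globally minimal `W`: good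
  ORDINARY reduction at `3` (the tree's `Additive.three_dvd_frobeniusTrace_iff_dvd_c₄`, Deuring in
  characteristic `3`) resp. MULTIPLICATIVE reduction at `3` (`X11b.LocalTorsion.dvd_Δ_and_not_dvd_c₄_of_mult`,
  Silverman VII.5.1(b)) give `3 ∤ c₄(E₀)`, hence `3 ∤ b₂(E₀)` (`c₄ = b₂² − 24b₄`), `E₀ = integralModelInt W`;
* **`gvPar_three_iff_abscissa_of_goodOrd` / `gvPar_three_iff_abscissa_of_mult` /
  `classX1_three_gvPar_iff_abscissa` / `classX2_three_gvPar_iff_abscissa`** — for a globally minimal `W`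
  at a good ordinary (resp. multiplicative, granted the Tate-uniformisation facts `hT`, `hT'` as in
  every X2 file) `3` and ANY rational root `x₀` of `Ψ₃`:
  **`GVPar W 3 ↔ (0 < b₂ + 12·x₀ ↔ den(x₀) ≠ 1)`** — type B iff (`x₀ > −b₂/12` and `x₀` is a third)
  or (`x₀ < −b₂/12` and `x₀` is an integer); type A otherwise (session 12's certificate theorems
  `gvPar_three_iff_of_cert_of_goodOrd` / `_of_mult` with `0 < D ↔ 0 < b₂ + 12x₀` from file 5 and
  `3 ∣ D ↔ den(x₀) ≠ 1` from file 6).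

Two remarks for readers of the series. (i) `b₂ + 12·x₀` is the `b₂` of the model translated by
`r = x₀` (Mathlib `WeierstrassCurve.variableChange_b₂ : (C • W).b₂ = u⁻²·(b₂ + 12r)`): the kernel
discriminant of a rational `3`-line is the square class of `b₂` of any model in which the kernel
point has abscissa `0`. (ii) File 5's `eval_Ψ₂Sq_ne_zero_of_eval_Ψ₃` (over `ℚ`, via the flex
identity) has a general-field twin already in the tree, found after file 5 landed:
`WeierstrassCurve.eval_Ψ₂Sq_ne_zero_of_eval_Ψ₃_eq_zero` (`Literature/…/ThreeTorsionRadicalProofs`,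
from `Res(Ψ₂², Ψ₃) = −Δ²`); either serves the certificate theorems.

CONSUMERS (EVIDENCE joins of the class-closure lane, nothing booked): cc-typer-6's `KDISC3`
certificate `(x₀, d)` — verdict `(d > 0) == (v₃(d) odd)` — is read here off `x₀` and `b₂` alone:
`(0 < b₂ + 12x₀) == (3 ∣ den x₀)`; cc-eng-1's E3L join (`HOME/class-closure/eng-1/`).

References: J. H. Silverman, *The Arithmetic of Elliptic Curves*, GTM 106 (2009), III.1, V.4.1,
VII.5.1, Exercise 3.7 [SilvermanAEC2009]; J. H. Silverman, *Advanced Topics*, GTM 151 (1994),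
Thm. V.5.3, Cor. V.5.4 [SilvermanATAEC1994]; R. Greenberg, V. Vatsal, Invent. Math. 142 (2000),
Thm. (1.3) [GreenbergVatsal2000]; HOME/b2b-bsdres-lit-cgls/CGLS-GV-TYPING.md §20.
-/

set_option autoImplicit false

noncomputable section

open scoped Classical NumberField

open WeierstrassCurve Polynomial Literature.NumberTheory.EllipticCurves
  Literature.NumberTheory.EllipticCurves.Rank1Residual Field IsDedekindDomain

namespace Summit.BirchSwinnertonDyer.Rank1Residual

namespace KernelDisc

variable {W : WeierstrassCurve ℚ}

/-! ### §16. The Greenberg–Vatsal type at `3` from the abscissa alone -/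

section Minimal

variable (W) [W.IsElliptic] [W.IsGloballyMinimal]

omit [W.IsElliptic] in
/-- **Good ORDINARY reduction at `3` ⇒ `3 ∤ b₂(E₀)`** for the integer minimal model
`E₀ = integralModelInt W` (the tree's `Additive.three_dvd_frobeniusTrace_iff_dvd_c₄`: at a good `3`,
`3 ∣ a₃ ↔ 3 ∣ c₄`; and `c₄ = b₂² − 24b₄ ≡ b₂² (mod 3)`). Silverman *AEC* V.4.1 (Deuring/Hasse
invariant in characteristic `3`). [folklore] -/
theorem not_three_dvd_b₂_of_goodOrd (hgood : W.HasGoodReductionAtPrime 3)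
    (hord : ¬ ((3 : ℕ) : ℤ) ∣ W.frobeniusTrace 3) : ¬ (3 : ℤ) ∣ (integralModelInt W).b₂ := by
  intro hb
  apply hord
  rw [Nat.cast_ofNat, Additive.three_dvd_frobeniusTrace_iff_dvd_c₄ W hgood]
  have : (integralModelInt W).c₄ = (integralModelInt W).b₂ ^ 2 - 24 * (integralModelInt W).b₄ := by
    simp [WeierstrassCurve.c₄]
  rw [this]
  exact dvd_sub (dvd_pow hb two_ne_zero) (dvd_mul_of_dvd_left (by norm_num) _)

/-- **MULTIPLICATIVE reduction at `3` ⇒ `3 ∤ b₂(E₀)`** (`3 ∤ c₄(E₀)` on the minimal model,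
`X11b.LocalTorsion.dvd_Δ_and_not_dvd_c₄_of_mult`; `c₄ ≡ b₂² (mod 3)`). Silverman *AEC* VII.5.1(b).
[cite: SilvermanAEC2009, VII.5 Prop. 5.1(b)] -/
theorem not_three_dvd_b₂_of_mult [Fact (Nat.Prime 3)] (hmult : W.HasMultiplicativeReductionAtPrime 3) :
    ¬ (3 : ℤ) ∣ (integralModelInt W).b₂ := by
  intro hb
  have hc := (X11b.LocalTorsion.dvd_Δ_and_not_dvd_c₄_of_mult W 3 hmult).2
  apply hc
  rw [Nat.cast_ofNat]
  have : (integralModelInt W).c₄ = (integralModelInt W).b₂ ^ 2 - 24 * (integralModelInt W).b₄ := by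
    simp [WeierstrassCurve.c₄]
  rw [this]
  exact dvd_sub (dvd_pow hb two_ne_zero) (dvd_mul_of_dvd_left (by norm_num) _)

variable {W}

/-- **THE GV TYPE AT A GOOD ORDINARY `3` FROM THE ABSCISSA ALONE.** For a globally minimal `W` with
good ordinary reduction at `3` and ANY rational root `x₀` of `Ψ₃`:
`GVPar W 3 ↔ (0 < b₂ + 12·x₀ ↔ den(x₀) ≠ 1)` — type B iff (`x₀ > −b₂/12` and `x₀` is a third) or
(`x₀ < −b₂/12` and `x₀` is an integer); type A otherwise. (Session 12's certificate theorem
`gvPar_three_iff_of_cert_of_goodOrd` with `0 < D ↔ 0 < b₂ + 12x₀` from §14 and `3 ∣ D ↔ den(x₀) ≠ 1`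
from §15.) [folklore] -/
theorem gvPar_three_iff_abscissa_of_goodOrd (hgood : W.HasGoodReductionAtPrime 3)
    (hord : ¬ ((3 : ℕ) : ℤ) ∣ W.frobeniusTrace 3) {x₀ : ℚ} (hψ : W.Ψ₃.eval x₀ = 0) :
    GVPar W 3 ↔ (0 < W.b₂ + 12 * x₀ ↔ x₀.den ≠ 1) := by
  haveI : Fact (Nat.Prime 3) := ⟨Nat.prime_three⟩
  have hb := not_three_dvd_b₂_of_goodOrd W hgood hord
  have hE := map_integralModelInt W
  obtain ⟨-, -, -, -, hc₄⟩ := b_cast_of_map_eq (integralModelInt W) hE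
  have hc₄0 : W.c₄ ≠ 0 := by
    rw [hc₄]
    have h : (integralModelInt W).c₄ ≠ 0 := fun h0 ↦ hb (by
      have h3 : (3 : ℤ) ∣ (integralModelInt W).b₂ ^ 2 := ⟨8 * (integralModelInt W).b₄, by
        have : (integralModelInt W).b₂ ^ 2 - 24 * (integralModelInt W).b₄ = 0 := by
          simpa [WeierstrassCurve.c₄] using h0
        linear_combination this⟩
      exact Int.prime_three.dvd_of_dvd_pow h3)
    exact_mod_cast h
  obtain ⟨Φ, D, s, -, hsq, hD0, hs, hDs, -⟩ := exists_cert_of_eval_Ψ₃_eq_zero' x₀ hψ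
  obtain ⟨t, ht, hDt⟩ := exists_mul_sq_eq_b₂_add hψ (b₂_add_ne_zero_of_eval_Ψ₃ hψ hc₄0) hD0 hs hDs
  rw [gvPar_three_iff_of_cert_of_goodOrd hψ hsq hs hDs hgood hord,
    three_dvd_kernelDisc_iff_den_ne_one (integralModelInt W) hE hψ hsq hs hDs hb, ← hDt,
    int_pos_iff_mul_sq_pos ht]

/-- **THE GV TYPE AT A MULTIPLICATIVE `3` FROM THE ABSCISSA ALONE** (globally minimal `W`, granted
the Tate-uniformisation facts `hT`, `hT'` as in every X2 file; ANY rational root `x₀` of `Ψ₃`):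
`GVPar W 3 ↔ (0 < b₂ + 12·x₀ ↔ den(x₀) ≠ 1)`. [cite: SilvermanATAEC1994, Thm. V.5.3 and Cor. V.5.4] -/
theorem gvPar_three_iff_abscissa_of_mult
    (hT : Silverman1994_thmV53_tateUniformisation.{0})
    (hT' : Silverman1994_thmV53_corV54_tateUniformisation.{0})
    (hmult : W.HasMultiplicativeReductionAtPrime 3) {x₀ : ℚ} (hψ : W.Ψ₃.eval x₀ = 0) :
    GVPar W 3 ↔ (0 < W.b₂ + 12 * x₀ ↔ x₀.den ≠ 1) := by
  haveI : Fact (Nat.Prime 3) := ⟨Nat.prime_three⟩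
  have hb := not_three_dvd_b₂_of_mult W hmult
  have hE := map_integralModelInt W
  obtain ⟨-, -, -, -, hc₄⟩ := b_cast_of_map_eq (integralModelInt W) hE
  have hc₄0 : W.c₄ ≠ 0 := by
    rw [hc₄]
    have h : (integralModelInt W).c₄ ≠ 0 := fun h0 ↦
      (X11b.LocalTorsion.dvd_Δ_and_not_dvd_c₄_of_mult W 3 hmult).2 (by rw [h0]; exact dvd_zero _)
    exact_mod_cast h
  obtain ⟨Φ, D, s, -, hsq, hD0, hs, hDs, -⟩ := exists_cert_of_eval_Ψ₃_eq_zero' x₀ hψ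
  obtain ⟨t, ht, hDt⟩ := exists_mul_sq_eq_b₂_add hψ (b₂_add_ne_zero_of_eval_Ψ₃ hψ hc₄0) hD0 hs hDs
  rw [gvPar_three_iff_of_cert_of_mult hψ hsq hs hDs hT hT' hmult,
    three_dvd_kernelDisc_iff_den_ne_one (integralModelInt W) hE hψ hsq hs hDs hb, ← hDt,
    int_pos_iff_mul_sq_pos ht]

/-- **CLASS X1 at `p = 3`, verdict from the abscissa** (`ClassX1 W 3`: reducible, good, anomalous —
hence ordinary, `goodOrd_of_anom`): for ANY rational root `x₀` of `Ψ₃`,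
`GVPar W 3 ↔ (0 < b₂ + 12·x₀ ↔ den(x₀) ≠ 1)`; N1′ (type B) iff the right side holds, N1 / N1″
(type A) iff it fails. Research route; no claim about BSD is made here. [folklore] -/
theorem classX1_three_gvPar_iff_abscissa (hX1 : ClassX1 W 3) {x₀ : ℚ} (hψ : W.Ψ₃.eval x₀ = 0) :
    GVPar W 3 ↔ (0 < W.b₂ + 12 * x₀ ↔ x₀.den ≠ 1) :=
  gvPar_three_iff_abscissa_of_goodOrd (goodOrd_of_anom W 3 hX1.2.2.2.1).1
    (goodOrd_of_anom W 3 hX1.2.2.2.1).2 hψ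

/-- **CLASS X2 at `p = 3`, verdict from the abscissa** (`ClassX2 W 3`: reducible, multiplicative;
granted `hT`, `hT'`): for ANY rational root `x₀` of `Ψ₃`,
`GVPar W 3 ↔ (0 < b₂ + 12·x₀ ↔ den(x₀) ≠ 1)` — the GV sub-cells (`CellA`, `Cell…GV`) iff the right
side holds. Research route; no claim about BSD is made here.
[cite: SilvermanATAEC1994, Thm. V.5.3 and Cor. V.5.4] -/
theorem classX2_three_gvPar_iff_abscissa
    (hT : Silverman1994_thmV53_tateUniformisation.{0})
    (hT' : Silverman1994_thmV53_corV54_tateUniformisation.{0}) (hX2 : ClassX2 W 3) {x₀ : ℚ}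
    (hψ : W.Ψ₃.eval x₀ = 0) : GVPar W 3 ↔ (0 < W.b₂ + 12 * x₀ ↔ x₀.den ≠ 1) :=
  gvPar_three_iff_abscissa_of_mult hT hT' hX2.2.2 hψ

end Minimal

end KernelDisc

end Summit.BirchSwinnertonDyer.Rank1Residual

end
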